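import Summits.KontsevichZagierPeriods.KontsevichZagierPeriods.Theorems.RootDecompWalshStrataEulerDescent02

/-!
# Conic descent, gen 6 (L4 one-variable Euler descent `[T, R(x)·√(ex²+fx+g)^{±1}] ∈ InBaker`), part 3/12

Declarations `InBaker.even_ellipse` … `InBaker.even_hyperbola_in` of the farm-checked gen-6 monolith; see the module docstring of
`EulerDescent01` (part 1) for the overview, the design and the sources. [KontsevichZagier2001 §1.1–1.2; BCR1998 §2.2; Euler 1768; this node gen 4 `sqrtDescent_*`]
-/

noncomputable section

open Literature.NumberTheory.Transcendental
open MeasureTheory Set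
open MvPolynomial (aeval)
open Literature.ModelTheory.ExponentialFields (IsSemialgebraic isSemialgebraic_univ
  isSemialgebraic_setOf_eval_pos isSemialgebraic_setOf_eval_lt isSemialgebraic_setOf_eval_le
  isSemialgebraic_setOf_eval_nonneg isSemialgebraic_setOf_eval_eq_zero continuous_aeval_real
  tarski_seidenberg_real_holds)

namespace Summit.KontsevichZagierPeriods.RootDecompWalshStrata.ConicDescent

/-- The derivative of `s ↦ s²` at `t` is `2t` (part-local `private` copy). [folklore] -/
private theorem hasDerivAt_sq' (t : ℝ) : HasDerivAt (fun s : ℝ => s ^ 2) (2 * t) t := by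
  simpa using hasDerivAt_pow 2 t

/-- The half-line `{t > 0}` is `ℚ`-semialgebraic (part-local `private` copy). [BCR1998 §2.2] -/
private theorem isSemialgebraic_pos' : IsSemialgebraic ℚ {v : Fin 1 → ℝ | 0 < v 0} := by
  convert isSemialgebraic_setOf_eval_pos (k := ℚ) (R := ℝ)
    (MvPolynomial.X (0 : Fin 1) : MvPolynomial (Fin 1) ℚ) using 1
  ext v
  simp

/-! #### 24.4 Even factors `S((x − x₀)²)·√D`: the gen-4 vertex charts are `ℚ`-rational in `u²` -/

/-- **Even factor, ellipse** (`e < 0 < h`): with `m = −e`, `ρ₀ = √(h/m)` and the gen-4 chart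
`x = x₀ + ρ₀(1 − m t²)/(1 + m t²)`, `t > 0`: `(x − x₀)² = (h/m)·W(t)² ∈ ℚ(t)` and
`√D·|dx/dt| = 8mh·t²/(1 + m t²)³`, so `S((x − x₀)²)√D dx` pulls back to a `ℚ`-rational form on
`{t > 0, Q((h/m)W(t)²) ≠ 0}`. [this node] -/
theorem InBaker.even_ellipse (e f g : ℚ) (he : e < 0) (hh : 0 < g - f ^ 2 / (4 * e))
    (P Q : Polynomial ℚ) (r : KZ.IntegralRep 1)
    (hQ : ∀ v ∈ r.domain, Polynomial.aeval ((v 0 - ((-f / (2 * e) : ℚ) : ℝ)) ^ 2) Q ≠ 0)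
    (hr : EqOn r.integrand (fun v =>
      Polynomial.aeval ((v 0 - ((-f / (2 * e) : ℚ) : ℝ)) ^ 2) P /
        Polynomial.aeval ((v 0 - ((-f / (2 * e) : ℚ) : ℝ)) ^ 2) Q * √(qD e f g (v 0))) r.domain) :
    InBaker (KZ.of r) := by
  refine InBaker.restrict_pos e f g r _ hr fun r₁ hsub hpos hr₁ => ?_
  have he0 : (e : ℝ) ≠ 0 := by exact_mod_cast he.ne
  have hm0 : (0 : ℝ) < ((-e : ℚ) : ℝ) := by push_cast; exact_mod_cast neg_pos.2 he
  have hh0 : (0 : ℝ) < ((g - f ^ 2 / (4 * e) : ℚ) : ℝ) := by exact_mod_cast hh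
  set M : ℝ := ((-e : ℚ) : ℝ) with hMdef
  set H : ℝ := ((g - f ^ 2 / (4 * e) : ℚ) : ℝ) with hHdef
  set X₀ : ℝ := ((-f / (2 * e) : ℚ) : ℝ) with hX₀def
  have hMe : M = -e := by rw [hMdef]; push_cast; ring
  have hHe : H = g - f ^ 2 / (4 * e) := by rw [hHdef]; push_cast; ring
  have hX₀e : X₀ = -f / (2 * e) := by rw [hX₀def]; push_cast; ring
  set ρ₀ : ℝ := √(H / M) with hρ₀def
  have hρ₀ : 0 < ρ₀ := Real.sqrt_pos.2 (div_pos hh0 hm0)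
  have hρ₀sq : ρ₀ ^ 2 = H / M := Real.sq_sqrt (div_pos hh0 hm0).le
  have hHρ : H = M * ρ₀ ^ 2 := by rw [hρ₀sq]; field_simp
  have hG : (g : ℝ) = M * ρ₀ ^ 2 + f ^ 2 / (4 * e) := by rw [← hHρ, hHe]; ring
  have hden : ∀ s : ℝ, 0 < 1 + M * s ^ 2 := fun s =>
    add_pos_of_pos_of_nonneg one_pos (mul_nonneg hm0.le (sq_nonneg s))
  set W : ℝ → ℝ := fun s => (1 - M * s ^ 2) / (1 + M * s ^ 2) with hWdef
  set gφ : ℝ → ℝ := fun s => X₀ + ρ₀ * W s with hgdef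
  set g' : ℝ → ℝ := fun s => ρ₀ * (-4 * M * s) / (1 + M * s ^ 2) ^ 2 with hg'def
  have hW : IsRatOn {v : Fin 1 → ℝ | 0 < v 0} fun v => W (v 0) :=
    (((IsRatOn.const 1).sub ((IsRatOn.const (-e)).mul (IsRatOn.coord.pow 2))).div
      ((IsRatOn.const 1).add ((IsRatOn.const (-e)).mul (IsRatOn.coord.pow 2))) fun v _ => by
        rw [Rat.cast_one, ← hMdef]; exact (hden (v 0)).ne').congr fun v _ => by
      simp only [hWdef, Rat.cast_one, hMdef]
  -- `U = (gφ − x₀)² = (h/m)·W²` is `ℚ`-rational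
  obtain ⟨U, hUdef⟩ : ∃ U : (Fin 1 → ℝ) → ℝ, U = fun v => H / M * W (v 0) ^ 2 := ⟨_, rfl⟩
  have hUv : ∀ v, U v = H / M * W (v 0) ^ 2 := fun v => by rw [hUdef]
  have hUg : ∀ v : Fin 1 → ℝ, (gφ (v 0) - X₀) ^ 2 = U v := fun v => by
    rw [hUv]; simp only [hgdef]; rw [← hρ₀sq]; ring
  have hU : IsRatOn {v : Fin 1 → ℝ | 0 < v 0} U :=
    ((IsRatOn.const ((g - f ^ 2 / (4 * e)) / (-e))).mul (hW.pow 2)).congr fun v _ => by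
      rw [hUv, hHdef, hMdef]; push_cast; ring
  obtain ⟨T₀, hT₀def⟩ : ∃ T₀ : Set (Fin 1 → ℝ),
      T₀ = {v | v ∈ {v : Fin 1 → ℝ | 0 < v 0} ∧ Polynomial.aeval (U v) Q ≠ 0} := ⟨_, rfl⟩
  have hT₀ : IsSemialgebraic ℚ T₀ := by
    rw [hT₀def]; exact (hU.polyAeval Q).isSemialgebraic_sep_ne_zero isSemialgebraic_pos'
  have hT₀sub : T₀ ⊆ {v : Fin 1 → ℝ | 0 < v 0} := fun v hv => by rw [hT₀def] at hv; exact hv.1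
  have hT₀Q : ∀ v ∈ T₀, Polynomial.aeval (U v) Q ≠ 0 := fun v hv => by
    rw [hT₀def] at hv; exact hv.2
  have hU₀ : IsRatOn T₀ U := hU.mono hT₀sub
  refine InBaker.of_cov₁_rat r₁ hT₀ gφ g' ?_ ?_ ?_ ?_
    (fun v => Polynomial.aeval (U v) P / Polynomial.aeval (U v) Q *
      (8 * M * H * v 0 ^ 2 / (1 + M * v 0 ^ 2) ^ 3)) ?_ fun v hv hvd => ?_
  · -- semialgebraic chart (gen 4), restricted to `T₀`
    have hρ : IsSemialgebraicFunOn ℚ {v : Fin 1 → ℝ | 0 < v 0} fun _ => ρ₀ :=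
      (IsSemialgebraicFunOn.sqrt_holds (isSemialgebraicFunOn_ratCast isSemialgebraic_pos'
        ((g - f ^ 2 / (4 * e)) / (-e)))).congr fun v _ => by
          rw [hρ₀def, hHdef, hMdef]; push_cast; ring_nf
    exact (((isSemialgebraicFunOn_ratCast isSemialgebraic_pos' (-f / (2 * e))).add_holds
      (hρ.mul_holds (hW.isSemialgebraicFunOn isSemialgebraic_pos'))).congr fun v _ => by
        simp only [hgdef, hX₀def, Pi.add_apply, Pi.mul_apply]).mono hT₀sub hT₀
  · -- derivative
    intro v _
    have h1 : HasDerivAt (fun s : ℝ => 1 - M * s ^ 2) (-(M * (2 * v 0))) (v 0) :=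
      ((hasDerivAt_sq' (v 0)).const_mul M).const_sub 1
    have h2 : HasDerivAt (fun s : ℝ => 1 + M * s ^ 2) (M * (2 * v 0)) (v 0) :=
      ((hasDerivAt_sq' (v 0)).const_mul M).const_add 1
    have h3 := ((h1.div h2 (hden (v 0)).ne').const_mul ρ₀).const_add X₀
    refine h3.congr_deriv ?_
    simp only [hg'def]
    field_simp
    ring
  · -- injective on `T₀ ⊆ {t > 0}`
    intro s hs t ht hst
    have hs0 : 0 < s 0 := hT₀sub hs
    have ht0 : 0 < t 0 := hT₀sub ht
    have h1 : W (s 0) = W (t 0) := by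
      have h' : X₀ + ρ₀ * W (s 0) = X₀ + ρ₀ * W (t 0) := hst
      exact mul_left_cancel₀ hρ₀.ne' (add_left_cancel h')
    have h1' : (1 - M * s 0 ^ 2) / (1 + M * s 0 ^ 2) = (1 - M * t 0 ^ 2) / (1 + M * t 0 ^ 2) := h1
    rw [div_eq_div_iff (hden _).ne' (hden _).ne'] at h1'
    have h2 : s 0 ^ 2 = t 0 ^ 2 := by
      have h3 : M * s 0 ^ 2 = M * t 0 ^ 2 := by linarith
      exact mul_left_cancel₀ hm0.ne' h3
    exact (pow_left_inj₀ hs0.le ht0.le two_ne_zero).1 h2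
  · -- surjective onto the domain
    intro x hx
    set u : ℝ := x 0 - X₀ with hudef
    have hD := hpos x hx
    rw [qD_eq_vertex e f g he.ne] at hD
    have hD' : 0 < (e : ℝ) * u ^ 2 + H := hD
    have hu2 : u ^ 2 < ρ₀ ^ 2 := by
      rw [hρ₀sq, lt_div_iff₀ hm0, hMe]
      linarith
    obtain ⟨hul, hur⟩ := abs_lt_of_sq_lt_sq' hu2 hρ₀.le
    have hpu : 0 < ρ₀ + u := by linarith
    have hmu : 0 < ρ₀ - u := by linarith
    set w : ℝ := √((ρ₀ - u) / (M * (ρ₀ + u))) with hwdef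
    have hwpos : 0 < w := Real.sqrt_pos.2 (div_pos hmu (mul_pos hm0 hpu))
    have hw2 : M * w ^ 2 = (ρ₀ - u) / (ρ₀ + u) := by
      rw [hwdef, Real.sq_sqrt (div_pos hmu (mul_pos hm0 hpu)).le]
      field_simp
    have hgw : gφ w = x 0 := by
      change X₀ + ρ₀ * ((1 - M * w ^ 2) / (1 + M * w ^ 2)) = x 0
      rw [hw2]
      have e1 : (1 : ℝ) - (ρ₀ - u) / (ρ₀ + u) = 2 * u / (ρ₀ + u) := by field_simp; ring
      have e2 : (1 : ℝ) + (ρ₀ - u) / (ρ₀ + u) = 2 * ρ₀ / (ρ₀ + u) := by field_simp; ring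
      rw [e1, e2]
      have : (2 * u / (ρ₀ + u)) / (2 * ρ₀ / (ρ₀ + u)) = u / ρ₀ := by
        field_simp
      rw [this, mul_div_cancel₀ u hρ₀.ne', hudef]
      ring
    refine ⟨fun _ => w, ?_, hgw⟩
    rw [hT₀def]
    refine ⟨hwpos, ?_⟩
    have hUw : U (fun _ => w) = (x 0 - X₀) ^ 2 := by rw [← hUg (fun _ => w)]; simp only [hgw]
    change Polynomial.aeval (U fun _ => w) Q ≠ 0
    rw [hUw]
    exact hQ x (hsub hx)
  · -- the pulled-back integrand is `ℚ`-rational on `T₀`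
    have hrat : IsRatOn T₀ fun v => 8 * M * H * v 0 ^ 2 / (1 + M * v 0 ^ 2) ^ 3 :=
      (((IsRatOn.const (8 * (-e) * (g - f ^ 2 / (4 * e)))).mul (IsRatOn.coord.pow 2)).div
        (((IsRatOn.const 1).add ((IsRatOn.const (-e)).mul (IsRatOn.coord.pow 2))).pow 3)
        fun v _ => by
          rw [Rat.cast_one, ← hMdef]; exact pow_ne_zero 3 (hden (v 0)).ne').congr fun v _ => by
        rw [hHdef, hMdef]; push_cast; ring
    exact ((hU₀.polyAeval P).div (hU₀.polyAeval Q) hT₀Q).mul hrat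
  · -- … and equals integrand ∘ chart × |chart′|
    have hv0 : 0 < v 0 := hT₀sub hv
    have hQv := hT₀Q v hv
    have hnum : 0 < 2 * ρ₀ * M * v 0 := by positivity
    have hWv : (e : ℝ) * (gφ (v 0)) ^ 2 + f * gφ (v 0) + g =
        (2 * ρ₀ * M * v 0 / (1 + M * v 0 ^ 2)) ^ 2 := by
      have hd := (hden (v 0)).ne'
      have heM : (e : ℝ) = -M := by rw [hMe]; ring
      have hM0 : M ≠ 0 := hm0.ne'
      simp only [hgdef, hWdef]
      rw [hG, hX₀e, heM]
      field_simp
      ring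
    have hsq : √((e : ℝ) * (gφ (v 0)) ^ 2 + f * gφ (v 0) + g) =
        2 * ρ₀ * M * v 0 / (1 + M * v 0 ^ 2) := by
      rw [hWv, Real.sqrt_sq (div_pos hnum (hden _)).le]
    have habs : |g' (v 0)| = ρ₀ * (4 * M * v 0) / (1 + M * v 0 ^ 2) ^ 2 := by
      simp only [hg'def]
      rw [show ρ₀ * (-4 * M * v 0) / (1 + M * v 0 ^ 2) ^ 2 =
          -(ρ₀ * (4 * M * v 0) / (1 + M * v 0 ^ 2) ^ 2) by ring, abs_neg, abs_of_pos]
      exact div_pos (by positivity) (pow_pos (hden _) 2)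
    rw [hr₁ hvd]
    have hlift : lift₁ gφ v 0 = gφ (v 0) := rfl
    simp only [qD, hlift]
    rw [hUg v, hsq, habs, hHρ]
    have hd := (hden (v 0)).ne'
    field_simp
    ring

/-- **Even factor, inner hyperbola** (`e > 0`, `h > 0`): with `a = √h` and the gen-4 chart
`x = x₀ + 2a·t/(e − t²)`, `t² < e`: `(x − x₀)² = 4h·t²/(e − t²)² ∈ ℚ(t)` and
`√D·dx/dt = 2h(e + t²)²/(e − t²)³`. [this node] -/
theorem InBaker.even_hyperbola_in (e f g : ℚ) (he : 0 < e) (hh : 0 < g - f ^ 2 / (4 * e))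
    (P Q : Polynomial ℚ) (r : KZ.IntegralRep 1)
    (hQ : ∀ v ∈ r.domain, Polynomial.aeval ((v 0 - ((-f / (2 * e) : ℚ) : ℝ)) ^ 2) Q ≠ 0)
    (hr : EqOn r.integrand (fun v =>
      Polynomial.aeval ((v 0 - ((-f / (2 * e) : ℚ) : ℝ)) ^ 2) P /
        Polynomial.aeval ((v 0 - ((-f / (2 * e) : ℚ) : ℝ)) ^ 2) Q * √(qD e f g (v 0))) r.domain) :
    InBaker (KZ.of r) := by
  have he0 : (0 : ℝ) < e := by exact_mod_cast he
  have hh0 : (0 : ℝ) < ((g - f ^ 2 / (4 * e) : ℚ) : ℝ) := by exact_mod_cast hh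
  set H : ℝ := ((g - f ^ 2 / (4 * e) : ℚ) : ℝ) with hHdef
  set X₀ : ℝ := ((-f / (2 * e) : ℚ) : ℝ) with hX₀def
  have hHe : H = g - f ^ 2 / (4 * e) := by rw [hHdef]; push_cast; ring
  have hX₀e : X₀ = -f / (2 * e) := by rw [hX₀def]; push_cast; ring
  set a : ℝ := √H with hadef
  have ha : 0 < a := Real.sqrt_pos.2 hh0
  have ha2 : a ^ 2 = H := Real.sq_sqrt hh0.le
  have hG : (g : ℝ) = a ^ 2 + f ^ 2 / (4 * e) := by rw [ha2, hHe]; ring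
  have hE : ∀ v : Fin 1 → ℝ, v ∈ {v : Fin 1 → ℝ | v 0 ^ 2 < e} → 0 < (e : ℝ) - v 0 ^ 2 :=
    fun v hv => sub_pos.2 hv
  set gφ : ℝ → ℝ := fun s => X₀ + 2 * a * (s / (e - s ^ 2)) with hgdef
  set g' : ℝ → ℝ := fun s => 2 * a * (e + s ^ 2) / (e - s ^ 2) ^ 2 with hg'def
  -- `U = (gφ − x₀)² = 4h·t²/(e − t²)²`
  obtain ⟨U, hUdef⟩ : ∃ U : (Fin 1 → ℝ) → ℝ,
      U = fun v => 4 * H * v 0 ^ 2 / ((e : ℝ) - v 0 ^ 2) ^ 2 := ⟨_, rfl⟩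
  have hUv : ∀ v, U v = 4 * H * v 0 ^ 2 / ((e : ℝ) - v 0 ^ 2) ^ 2 := fun v => by rw [hUdef]
  have hUg : ∀ v : Fin 1 → ℝ, v ∈ {v : Fin 1 → ℝ | v 0 ^ 2 < e} → (gφ (v 0) - X₀) ^ 2 = U v :=
    fun v hv => by
      have hd := (hE v hv).ne'
      rw [hUv, ← ha2]; simp only [hgdef]; field_simp; ring
  have hU : IsRatOn {v : Fin 1 → ℝ | v 0 ^ 2 < e} U :=
    (((IsRatOn.const (4 * (g - f ^ 2 / (4 * e)))).mul (IsRatOn.coord.pow 2)).div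
      (((IsRatOn.const e).sub (IsRatOn.coord.pow 2)).pow 2) fun v hv =>
        pow_ne_zero 2 (hE v hv).ne').congr fun v _ => by
      rw [hUv, hHdef]; push_cast; ring
  obtain ⟨T₀, hT₀def⟩ : ∃ T₀ : Set (Fin 1 → ℝ),
      T₀ = {v | v ∈ {v : Fin 1 → ℝ | v 0 ^ 2 < e} ∧ Polynomial.aeval (U v) Q ≠ 0} := ⟨_, rfl⟩
  have hT₀ : IsSemialgebraic ℚ T₀ := by
    rw [hT₀def]; exact (hU.polyAeval Q).isSemialgebraic_sep_ne_zero (isSemialgebraic_T_sq_lt e)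
  have hT₀sub : T₀ ⊆ {v : Fin 1 → ℝ | v 0 ^ 2 < e} := fun v hv => by rw [hT₀def] at hv; exact hv.1
  have hT₀Q : ∀ v ∈ T₀, Polynomial.aeval (U v) Q ≠ 0 := fun v hv => by
    rw [hT₀def] at hv; exact hv.2
  have hU₀ : IsRatOn T₀ U := hU.mono hT₀sub
  refine InBaker.of_cov₁_rat r hT₀ gφ g' ?_ ?_ ?_ ?_
    (fun v => Polynomial.aeval (U v) P / Polynomial.aeval (U v) Q *
      (2 * H * ((e : ℝ) + v 0 ^ 2) ^ 2 / ((e : ℝ) - v 0 ^ 2) ^ 3)) ?_ fun v hv hvd => ?_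
  · -- semialgebraic (gen 4), restricted
    have hq : IsSemialgebraicFunOn ℚ {v : Fin 1 → ℝ | v 0 ^ 2 < e} fun v => v 0 / (e - v 0 ^ 2) :=
      (isSemialgebraicFunOn_aeval_div_aeval (isSemialgebraic_T_sq_lt e) (MvPolynomial.X 0)
        (MvPolynomial.C e - MvPolynomial.X 0 ^ 2) fun v hv => by
          simp only [map_sub, map_pow, MvPolynomial.aeval_C, MvPolynomial.aeval_X, eq_ratCast]
          exact (hE v hv).ne').congr fun v _ => by
        simp only [map_sub, map_pow, MvPolynomial.aeval_C, MvPolynomial.aeval_X, eq_ratCast]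
    have hc : IsSemialgebraicFunOn ℚ {v : Fin 1 → ℝ | v 0 ^ 2 < e} fun _ => 2 * a :=
      ((isSemialgebraicFunOn_ratCast (isSemialgebraic_T_sq_lt e) 2).mul_holds
        (IsSemialgebraicFunOn.sqrt_holds (isSemialgebraicFunOn_ratCast (isSemialgebraic_T_sq_lt e)
        (g - f ^ 2 / (4 * e))))).congr fun v _ => by
          simp only [Pi.mul_apply, hadef, hHdef]; push_cast; ring_nf
    exact (((isSemialgebraicFunOn_ratCast (isSemialgebraic_T_sq_lt e) (-f / (2 * e))).add_holds
      (hc.mul_holds hq)).congr fun v _ => by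
        simp only [hgdef, hX₀def, Pi.add_apply, Pi.mul_apply]).mono hT₀sub hT₀
  · -- derivative
    intro v hv
    have hv' := hT₀sub hv
    have h1 : HasDerivAt (fun s : ℝ => (e : ℝ) - s ^ 2) (-(2 * v 0)) (v 0) :=
      (hasDerivAt_sq' (v 0)).const_sub (e : ℝ)
    have h2 := (((hasDerivAt_id (v 0)).div h1 (hE v hv').ne').const_mul (2 * a)).const_add X₀
    refine h2.congr_deriv ?_
    have hd := (hE v hv').ne'
    simp only [hg'def, id]
    field_simp
    ring
  · -- injective on `t² < e`
    intro s hs t ht hst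
    have hs' := hT₀sub hs
    have ht' := hT₀sub ht
    have hs'' : s 0 ^ 2 < e := hs'
    have ht'' : t 0 ^ 2 < e := ht'
    have h1 : s 0 / (e - s 0 ^ 2) = t 0 / (e - t 0 ^ 2) := by
      have h' : X₀ + 2 * a * (s 0 / (e - s 0 ^ 2)) = X₀ + 2 * a * (t 0 / (e - t 0 ^ 2)) := hst
      exact mul_left_cancel₀ (by positivity) (add_left_cancel h')
    rw [div_eq_div_iff (hE s hs').ne' (hE t ht').ne'] at h1
    have h2 : (s 0 - t 0) * ((e : ℝ) + s 0 * t 0) = 0 := by linear_combination h1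
    rcases mul_eq_zero.1 h2 with h3 | h3
    · linarith
    · nlinarith [sq_nonneg (s 0 + t 0)]
  · -- surjective (onto everything)
    intro x hx
    obtain ⟨u, hudef⟩ : ∃ u : ℝ, u = x 0 - X₀ := ⟨_, rfl⟩
    have hHu : 0 < H + e * u ^ 2 := by positivity
    obtain ⟨S, hSdef⟩ : ∃ S : ℝ, S = √(H + e * u ^ 2) := ⟨_, rfl⟩
    have hS : 0 < S := by rw [hSdef]; exact Real.sqrt_pos.2 hHu
    have hS2 : S ^ 2 = H + e * u ^ 2 := by rw [hSdef]; exact Real.sq_sqrt hHu.le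
    obtain ⟨d, hddef⟩ : ∃ d : ℝ, d = a + S := ⟨_, rfl⟩
    have hd : 0 < d := by rw [hddef]; exact add_pos ha hS
    have hd0 : d ≠ 0 := hd.ne'
    have hd2 : d ^ 2 - e * u ^ 2 = 2 * a * d := by
      rw [hddef]
      linear_combination hS2 - ha2
    obtain ⟨t, htdef⟩ : ∃ t : ℝ, t = e * u / d := ⟨_, rfl⟩
    have het : (e : ℝ) - t ^ 2 = 2 * e * a / d := by
      have h1 : (e : ℝ) - t ^ 2 = e * (d ^ 2 - e * u ^ 2) / d ^ 2 := by
        rw [htdef]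
        field_simp
      rw [h1, hd2]
      field_simp
    have het0 : 0 < (e : ℝ) - t ^ 2 := by rw [het]; positivity
    have hmem : (fun _ : Fin 1 => t) ∈ {v : Fin 1 → ℝ | v 0 ^ 2 < e} := by
      simpa [sub_pos] using het0
    have hgt : gφ t = x 0 := by
      change X₀ + 2 * a * (t / (e - t ^ 2)) = x 0
      have hea : (2 : ℝ) * e * a ≠ 0 := by positivity
      rw [het, htdef]
      field_simp
      rw [hudef]
      ring
    refine ⟨fun _ => t, ?_, hgt⟩
    rw [hT₀def]
    refine ⟨hmem, ?_⟩
    have hUt : U (fun _ => t) = (x 0 - X₀) ^ 2 := by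
      rw [← hUg (fun _ => t) hmem]; simp only [hgt]
    change Polynomial.aeval (U fun _ => t) Q ≠ 0
    rw [hUt]
    exact hQ x hx
  · -- rational integrand
    have hrat : IsRatOn T₀ fun v => 2 * H * ((e : ℝ) + v 0 ^ 2) ^ 2 / ((e : ℝ) - v 0 ^ 2) ^ 3 :=
      (((IsRatOn.const (2 * (g - f ^ 2 / (4 * e)))).mul
        (((IsRatOn.const e).add (IsRatOn.coord.pow 2)).pow 2)).div
        (((IsRatOn.const e).sub (IsRatOn.coord.pow 2)).pow 3) fun v hv =>
          pow_ne_zero 3 (hE v (hT₀sub hv)).ne').congr fun v _ => by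
        rw [hHdef]; push_cast; ring
    exact ((hU₀.polyAeval P).div (hU₀.polyAeval Q) hT₀Q).mul hrat
  · -- pulled-back integrand
    have hv' := hT₀sub hv
    have hEv := hE v hv'
    have hQv := hT₀Q v hv
    have hd : (e : ℝ) - v 0 ^ 2 ≠ 0 := hEv.ne'
    have hnum : 0 < a * ((e : ℝ) + v 0 ^ 2) / (e - v 0 ^ 2) := by positivity
    have hWv : (e : ℝ) * (gφ (v 0)) ^ 2 + f * gφ (v 0) + g =
        (a * ((e : ℝ) + v 0 ^ 2) / (e - v 0 ^ 2)) ^ 2 := by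
      simp only [hgdef]
      rw [hG, hX₀e]
      field_simp
      ring
    have hsq : √((e : ℝ) * (gφ (v 0)) ^ 2 + f * gφ (v 0) + g) =
        a * ((e : ℝ) + v 0 ^ 2) / (e - v 0 ^ 2) := by
      rw [hWv, Real.sqrt_sq hnum.le]
    have habs : |g' (v 0)| = 2 * a * (e + v 0 ^ 2) / (e - v 0 ^ 2) ^ 2 := by
      simp only [hg'def]
      exact abs_of_pos (by positivity)
    rw [hr hvd]
    have hlift : lift₁ gφ v 0 = gφ (v 0) := rfl
    simp only [qD, hlift]
    rw [hUg v hv', hsq, habs, ← ha2]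
    field_simp

end Summit.KontsevichZagierPeriods.RootDecompWalshStrata.ConicDescent
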